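import Summits.NavierStokesRegularity.NavierStokesRegularity.Theorems.ScenarioCensusRowF1TwoTimeTopTransfer
import HarnessLib

/-!
# LINE 34 «two-time-top» port, part 4/4: §5 the four rows are EXCLUDED (`rowF1dj_holds`, `rowF1gl_holds`, `rowF1ge_holds`, `rowF1de_holds`), the floors (`persistentTops_holds`,
# `twoTimeFloor_holds`), the residual ≡ `Row_F1`; §6 anchors (sharpness of `q < 1` at a self-similar profile; relations between cells); census KEYS `Row_F1dj` / `Row_F1gl` /
# `Row_F1ge` / `Row_F1de` + `_excluded`, floors PT / TTF

Re-homed for the scenario census (typer seat ns-census-typer-1 g9; the cells F1dj / F1gl / F1ge / F1de and the floors are MEMBERS OF RECORD «DECIDED IN KERNEL IN FILES» of row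
F1 since census v1.100 (item 70: critic PASS; ref ns-census-ref g13 PRE-CHECK ✓ §18.6; lead-presearch label); this port makes them TREE-decided): VERBATIM PORT of
ns-idea-3 LINE 34 «two-time-top», `pub/ideators/ns-idea-3/lines/two-time-top/line-two-time-top.lean` sha16 26867eeb269186b0 (1077 l., lean check rc 0, 0 sorry), split
for the 400-line rule into `ScenarioCensusRowF1TwoTimeTop` (§1–§2) → `…TwoTimeTopSignals` (§3) → `…TwoTimeTopTransfer` (§4) → `…TwoTimeTopRows` (§5–§6 + census KEYS).
Lean text VERBATIM in namespace `…Theorems.ScenarioCensus.TwoTimeTop` (the line's `…Cruxes.ScenarioCensusRowF1.TwoTimeTopLine` re-homed); port edits: §2's zoom package /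
`tendsto_physicalTime` / `eventually_top` (LINES 15/33 VERBATIM) are taken BY NAME from the landed columnar-top / symmetric-top ports; `@[conjecture]` on the residual
`PersistenceCollapse` (≡ `ScenarioCensus.Row_F1`, OPEN); docstrings complete.  Statements untouched.

No census VALUE is moved here (row F1 stays OPEN-WITH-LINE; the members become TREE-decided by name); NS regularity is NOT proved; `Row_F1` is untouched (zero
movement, `persistenceCollapse_iff_rowF1`); no summit statement is proved by this file. Lemmas that restate already-landed tree declarations are taken BY NAME (gate lint `dedup.landed`): `exists_singularZoom_package` = `ColumnarTop.exists_singularZoom_package`, `tendsto_physicalTime` = `ColumnarTop.tendsto_physicalTime`, `eventually_top` = `SymmetricTop.eventually_top`.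
-/

-- the summit and its single problem share the name `NavierStokesRegularity` (D-0017 nested layout)
set_option linter.dupNamespace false

noncomputable section

open MeasureTheory Set Function Filter TopologicalSpace Metric
open scoped Topology NNReal ENNReal

namespace Summit.NavierStokesRegularity.NavierStokesRegularity.Theorems.ScenarioCensus.TwoTimeTop

open Literature.Analysis Literature.Analysis.FluidPDE
open Summit.NavierStokesRegularity.NavierStokesRegularity.Theorems
open Summit.NavierStokesRegularity.NavierStokesRegularity.Theses

/-! ## §5 The four rows are EXCLUDED; the floors PROVED; the residual ≡ row F1 -/

/-- The blow-up contrapositive shared by the four rows: a backward-singular point of a Type-I Clay solution yields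
a zoom package; the transferred read-out kills the nontrivial limit. -/
theorem hasSmoothExtensionPast_of_kill {ν T : ℝ} (hν : 0 < ν) (hT : 0 < T)
    {u : ℝ → E3 → E3} {p : ℝ → E3 → ℝ}
    (hsol : IsClassicalNSSolutionOn (Ico 0 T) ν 0 u p) (hLH : IsLerayHopfOn T ν 0 (u 0) u)
    (hdec : HasRapidSpatialDecay (u 0)) (hTI : IsTypeIBlowup u T)
    (kill : ∀ (x₀ : E3) (C α β R : ℝ) (c : ℕ → ℝ) (W : ℝ → E3 → E3),
      0 < α → 0 < β → (∀ j, 0 < c j) → Tendsto c atTop (𝓝 0) → IsTypeIAncientMild C W →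
      (∀ t < 0, ∀ y : E3,
        Tendsto (fun j => (c j * α) • u (T + c j ^ 2 * β * t) (x₀ + (c j * R) • y)) atTop (𝓝 (W t y))) →
      ∀ t < 0, ∀ y : E3, W t y = 0) :
    HasSmoothExtensionPast ν 0 u T := by
  apply hasSmoothExtensionPast_of_forall_exists_parabolicCylinder hν hT hsol hLH hdec
  intro x₀
  by_contra hno
  have hsing : ∀ r : ℝ, 0 < r →
      eLpNorm (uncurry u) ∞ (volume.restrict (parabolicCylinder r ((T : ℝ), x₀))) = ∞ := by
    intro r hr
    by_contra h
    exact hno ⟨r, hr, lt_top_iff_ne_top.2 h⟩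
  obtain ⟨C, α, β, R, c, W, hα, hβ, -, hcpos, hclim, hW, hpt, -, t, ht, y, hne⟩ :=
    ColumnarTop.exists_singularZoom_package hν hT hsol hLH hdec hTI x₀ hsing
  exact hne (kill x₀ C α β R c W hα hβ hcpos hclim hW hpt t ht y)

/-- **Criterion row F1dj is EXCLUDED** (in kernel): disjoint tops at some lag ⇒ no Type-I blow-up. -/
theorem rowF1dj_holds : Row_F1dj := by
  intro ν T hν hT u p hsol hLH hdec hTI hH
  obtain ⟨θ, hθ, hH⟩ := hH
  exact hasSmoothExtensionPast_of_kill hν hT hsol hLH hdec hTI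
    fun x₀ C α β R c W hα hβ hcpos hclim hW hpt =>
      eq_zero_of_disjointTimes hW hθ (disjointTops_transfer hν hα hβ hcpos hclim hpt hθ hH)

/-- **Criterion row F1gl is EXCLUDED** (in kernel): late-anchored super-self-similar growth ⇒ no Type-I blow-up. -/
theorem rowF1gl_holds : Row_F1gl := by
  intro ν T hν hT u p hsol hLH hdec hTI hH
  obtain ⟨θ, q, hθ, hq, hH⟩ := hH
  exact hasSmoothExtensionPast_of_kill hν hT hsol hLH hdec hTI
    fun x₀ C α β R c W hα hβ hcpos hclim hW hpt =>
      eq_zero_of_lateGrowth hW hθ hq (lateGrowth_transfer hν hα hβ hcpos hclim hpt hθ hH)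

/-- **Criterion row F1ge is EXCLUDED** (in kernel): early-anchored super-self-similar growth ⇒ no Type-I
blow-up. -/
theorem rowF1ge_holds : Row_F1ge := by
  intro ν T hν hT u p hsol hLH hdec hTI hH
  obtain ⟨θ, q, hθ, hq, hH⟩ := hH
  exact hasSmoothExtensionPast_of_kill hν hT hsol hLH hdec hTI
    fun x₀ C α β R c W hα hβ hcpos hclim hW hpt =>
      eq_zero_of_earlyGrowth hW hθ hq (earlyGrowth_transfer hν hα hβ hcpos hclim hpt hθ hH)

/-- **Criterion row F1de is EXCLUDED** (in kernel): early-anchored fast dimming ⇒ no Type-I blow-up. -/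
theorem rowF1de_holds : Row_F1de := by
  intro ν T hν hT u p hsol hLH hdec hTI hH
  obtain ⟨θ, q, hθ, hq, hH⟩ := hH
  exact hasSmoothExtensionPast_of_kill hν hT hsol hLH hdec hTI
    fun x₀ C α β R c W hα hβ hcpos hclim hW hpt =>
      eq_zero_of_earlyDecay hW hθ hq (earlyDecay_transfer hν hα hβ hcpos hclim hpt hθ hH)

/-- **PERSISTENT TOPS** (structural theorem, in kernel). -/
theorem persistentTops_holds : PersistentTops := by
  intro ν T hν hT u p hmax hLH hdec hTI θ hθ hH
  exact hmax.2 (rowF1dj_holds ν T hν hT u p hmax.1 hLH hdec hTI ⟨θ, hθ, hH⟩)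

/-- **TWO-TIME FLOOR** (structural theorem, in kernel). -/
theorem twoTimeFloor_holds : TwoTimeFloor := by
  intro ν T hν hT u p hmax hLH hdec hTI θ q hθ hq
  exact ⟨fun hH => hmax.2 (rowF1gl_holds ν T hν hT u p hmax.1 hLH hdec hTI ⟨θ, q, hθ, hq, hH⟩),
    fun hH => hmax.2 (rowF1ge_holds ν T hν hT u p hmax.1 hLH hdec hTI ⟨θ, q, hθ, hq, hH⟩),
    fun hH => hmax.2 (rowF1de_holds ν T hν hT u p hmax.1 hLH hdec hTI ⟨θ, q, hθ, hq, hH⟩)⟩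

/-- **PERSISTENT TOPS, unfolded** (display form): for every lag `θ > 0` there is a level `Λ > 0` such that at
times arbitrarily close to `T` some point is `Λ`-fast both at `t − θ(T − t)` and at `t`. -/
theorem persistentTops_unfolded : ∀ (ν T : ℝ), 0 < ν → 0 < T →
    ∀ (u : ℝ → E3 → E3) (p : ℝ → E3 → ℝ),
    IsMaximalSmoothSolution ν 0 u p T → IsLerayHopfOn T ν 0 (u 0) u →
    HasRapidSpatialDecay (u 0) → IsTypeIBlowup u T →
    ∀ θ : ℝ, 0 < θ → ∃ Λ : ℝ, 0 < Λ ∧ ∀ t₁ < T, ∃ t ∈ Ioo t₁ T, ∃ x : E3,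
      Λ * Real.sqrt ν ≤ Real.sqrt (T - lagTime T θ t) * ‖u (lagTime T θ t) x‖ ∧
      Λ * Real.sqrt ν ≤ Real.sqrt (T - t) * ‖u t x‖ := by
  intro ν T hν hT u p hmax hLH hdec hTI θ hθ
  have h := persistentTops_holds ν T hν hT u p hmax hLH hdec hTI θ hθ
  by_contra hcon
  apply h
  intro Λ hΛ
  by_contra hev
  apply hcon
  refine ⟨Λ, hΛ, fun t₁ ht₁ => ?_⟩
  by_contra hno
  push Not at hno
  exact hev (eventually_of_mem (Ioo_mem_nhdsLT ht₁) fun t ht =>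
    Set.disjoint_left.2 fun x hx1 hx2 => absurd hx2 (not_le.2 (hno t ht x hx1)))

/-- **TWO-TIME FLOOR, unfolded for (GL)** (display form): for every lag `θ > 0` and ratio `q < 1` there is a level
`Λ > 0` such that at times arbitrarily close to `T` some `Λ`-fast point has grown over the lag by LESS than the
factor `q⁻¹√(1+θ)⁻¹`… precisely `q|u(t, x)| < √(1+θ)|u(t − θ(T−t), x)|`. -/
theorem twoTimeFloor_gl_unfolded : ∀ (ν T : ℝ), 0 < ν → 0 < T →
    ∀ (u : ℝ → E3 → E3) (p : ℝ → E3 → ℝ),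
    IsMaximalSmoothSolution ν 0 u p T → IsLerayHopfOn T ν 0 (u 0) u →
    HasRapidSpatialDecay (u 0) → IsTypeIBlowup u T →
    ∀ θ q : ℝ, 0 < θ → q < 1 → ∃ Λ : ℝ, 0 < Λ ∧ ∀ t₁ < T, ∃ t ∈ Ioo t₁ T, ∃ x : E3,
      Λ * Real.sqrt ν ≤ Real.sqrt (T - t) * ‖u t x‖ ∧
      q * ‖u t x‖ < Real.sqrt (1 + θ) * ‖u (lagTime T θ t) x‖ := by
  intro ν T hν hT u p hmax hLH hdec hTI θ q hθ hq
  have h := (twoTimeFloor_holds ν T hν hT u p hmax hLH hdec hTI θ q hθ hq).1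
  by_contra hcon
  apply h
  intro Λ hΛ
  by_contra hev
  apply hcon
  refine ⟨Λ, hΛ, fun t₁ ht₁ => ?_⟩
  by_contra hno
  push Not at hno
  exact hev (eventually_of_mem (Ioo_mem_nhdsLT ht₁) fun t ht x hx => hno t ht x hx)

/-- **Row F1 ≡ PersistenceCollapse** (exact reformulation, in kernel). -/
theorem persistenceCollapse_iff_rowF1 : PersistenceCollapse ↔ ScenarioCensus.Row_F1 :=
  ⟨fun h => rowF1_of rowF1dj_holds h, persistenceCollapse_of_rowF1⟩

/-- **Composition concluding the target BY NAME**: `PersistenceCollapse → Row_F1`. -/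
theorem rowF1_of_persistenceCollapse : PersistenceCollapse → ScenarioCensus.Row_F1 :=
  persistenceCollapse_iff_rowF1.1

/-! ## §6 Anchors: sharpness of the threshold `q < 1` at an exactly self-similar profile; relations between cells -/

/-- **Sharpness anchor.** For a field which is EXACTLY backward self-similar about `(T, x₀)`
(`u(s, x) = (T−s)^{-1/2} U((x − x₀)/√(T−s))`), the two-time ratio at the centre is exactly the self-similar factor:
`√(1+θ)|u(t − θ(T−t), x₀)| = |u(t, x₀)|`.  So each ratio read-out (GL/GE/DE) fails, with ANY `q < 1`, at the centre
of a putative self-similar blow-up (whose exclusion is a different theorem: Nečas–Růžička–Šverák, Tsai): the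
threshold `q < 1` is the self-similar rate, and the rows are disjoint from the self-similar scenario rather than a
re-proof of it. -/
theorem selfSimilar_centre_ratio {T θ t : ℝ} (hθ : 0 < θ) (ht : t < T) (U : E3 → E3) (x₀ : E3)
    (u : ℝ → E3 → E3)
    (hu : ∀ s < T, ∀ x, u s x = (Real.sqrt (T - s))⁻¹ • U ((Real.sqrt (T - s))⁻¹ • (x - x₀))) :
    Real.sqrt (1 + θ) * ‖u (lagTime T θ t) x₀‖ = ‖u t x₀‖ := by
  have hκ : 0 < 1 + θ := by linarith
  have hTt : 0 < T - t := sub_pos.2 ht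
  have hlt : lagTime T θ t < T := (lagTime_lt T θ t hθ ht).trans ht
  have h1 : u (lagTime T θ t) x₀ = (Real.sqrt (T - lagTime T θ t))⁻¹ • U 0 := by
    rw [hu _ hlt, sub_self, smul_zero]
  have h2 : u t x₀ = (Real.sqrt (T - t))⁻¹ • U 0 := by
    rw [hu _ ht, sub_self, smul_zero]
  rw [h1, h2, norm_smul, norm_smul, norm_inv, norm_inv, Real.norm_eq_abs, Real.norm_eq_abs,
    abs_of_nonneg (Real.sqrt_nonneg _), abs_of_nonneg (Real.sqrt_nonneg _), sub_lagTime,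
    Real.sqrt_mul hκ.le]
  have hsκ : 0 < Real.sqrt (1 + θ) := Real.sqrt_pos.2 hκ
  have hsT : 0 < Real.sqrt (T - t) := Real.sqrt_pos.2 hTt
  field_simp

/-- **Order: the level row dominates the `q ≤ 0` endpoint of (GL)** (for `θ > -1`).  Late-anchored growth with a ratio
`q ≤ 0` forces the lagged speed to vanish on the late top, so the tops at the two times are disjoint. -/
theorem hasDisjointTops_of_lateGrowth_nonpos {ν T θ q : ℝ} {u : ℝ → E3 → E3} (hν : 0 < ν) (hθ : -1 < θ) (hq : q ≤ 0)
    (h : HasLateGrowth ν T θ q u) : HasDisjointTops ν T θ u := by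
  intro Λ hΛ
  filter_upwards [h Λ hΛ] with t ht
  rw [Set.disjoint_left]
  intro x hx1 hx2
  have h1 := ht x hx2
  have hsν : 0 < Real.sqrt ν := Real.sqrt_pos.2 hν
  have hsκ : 0 < Real.sqrt (1 + θ) := Real.sqrt_pos.2 (by linarith)
  have h0 : Real.sqrt (1 + θ) * ‖u (lagTime T θ t) x‖ ≤ 0 :=
    h1.trans (mul_nonpos_of_nonpos_of_nonneg hq (norm_nonneg _))
  have hu0 : u (lagTime T θ t) x = 0 := by
    have : ‖u (lagTime T θ t) x‖ ≤ 0 := by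
      by_contra hlt
      push Not at hlt
      exact absurd h0 (not_le.2 (mul_pos hsκ hlt))
    exact norm_le_zero_iff.1 this
  rw [mem_topSet, hu0, norm_zero, mul_zero] at hx1
  exact absurd hx1 (not_le.2 (by positivity))

/-- **Order: the level row dominates the `q ≤ 0` endpoint of (DE).**  Early-anchored dimming with `q ≤ 0`
forces the late speed to vanish at every early-fast point. -/
theorem hasDisjointTops_of_earlyDecay_nonpos {ν T θ q : ℝ} {u : ℝ → E3 → E3} (hν : 0 < ν) (hq : q ≤ 0)
    (h : HasEarlyDecay ν T θ q u) : HasDisjointTops ν T θ u := by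
  intro Λ hΛ
  filter_upwards [h Λ hΛ] with t ht
  rw [Set.disjoint_left]
  intro x hx1 hx2
  have h1 := ht x hx1
  have hsν : 0 < Real.sqrt ν := Real.sqrt_pos.2 hν
  have h0 : ‖u t x‖ ≤ 0 :=
    h1.trans (mul_nonpos_of_nonpos_of_nonneg (mul_nonpos_of_nonpos_of_nonneg hq (Real.sqrt_nonneg _)) (norm_nonneg _))
  have hu0 : u t x = 0 := norm_le_zero_iff.1 h0
  rw [mem_topSet, hu0, norm_zero, mul_zero] at hx2
  exact absurd hx2 (not_le.2 (by positivity))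

/-- **Cells (GL) and (GE) coincide in the limit** (record): both transfer to the SAME un-anchored contraction of
the limit signal, by un-anchoring; in particular `Row_F1gl` and `Row_F1ge` are proved by one engine although
neither physical hypothesis implies the other. Stated here as the common limit statement they both reach. -/
theorem growth_cells_common_limit {C θ q : ℝ} {W : ℝ → E3 → E3} (hW : IsTypeIAncientMild C W) (hθ : 0 < θ)
    (h : (∀ t < 0, ∀ y : E3, W t y ≠ 0 → Real.sqrt (1 + θ) * ‖W ((1 + θ) * t) y‖ ≤ q * ‖W t y‖) ∨
      (∀ t < 0, ∀ y : E3, W ((1 + θ) * t) y ≠ 0 →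
        Real.sqrt (1 + θ) * ‖W ((1 + θ) * t) y‖ ≤ q * ‖W t y‖)) :
    ∀ t < 0, ∀ y : E3, Real.sqrt (1 + θ) * ‖W ((1 + θ) * t) y‖ ≤ q * ‖W t y‖ := by
  have hκ : 0 < 1 + θ := by linarith
  intro t ht y
  have hcont : ∀ s < 0, ContinuousAt (fun s => q * ‖W s y‖ - Real.sqrt (1 + θ) * ‖W ((1 + θ) * s) y‖) s :=
    fun s hs => by
      have h1 : ContinuousAt (fun r : ℝ => W (1 * r) y) s := continuousAt_signal hW y one_pos hs
      simp only [one_mul] at h1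
      have h2 := continuousAt_signal hW y hκ hs
      exact (h1.norm.const_mul q).sub (h2.norm.const_mul _)
  have hzero : (∀ t < 0, W t y = 0) →
      ∀ s < 0, 0 ≤ q * ‖W s y‖ - Real.sqrt (1 + θ) * ‖W ((1 + θ) * s) y‖ := fun hz s hs => by
    have hks : (1 + θ) * s < 0 := mul_neg_of_pos_of_neg hκ hs
    simp only [hz s hs, hz _ hks, norm_zero, mul_zero, sub_zero, le_refl]
  rcases h with h | h
  · exact sub_nonneg.1 (forall_nonneg_of_anchored hW y one_pos hcont
      (fun s hs hne => by rw [one_mul] at hne; exact sub_nonneg.2 (h s hs y hne)) hzero t ht)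
  · exact sub_nonneg.1 (forall_nonneg_of_anchored hW y hκ hcont
      (fun s hs hne => sub_nonneg.2 (h s hs y hne)) hzero t ht)

/-- **LINE 34 in one place.** -/
theorem twoTimeTop_summary :
    Row_F1dj ∧ Row_F1gl ∧ Row_F1ge ∧ Row_F1de ∧ PersistentTops ∧ TwoTimeFloor ∧
      (PersistenceCollapse ↔ ScenarioCensus.Row_F1) :=
  ⟨rowF1dj_holds, rowF1gl_holds, rowF1ge_holds, rowF1de_holds, persistentTops_holds, twoTimeFloor_holds,
    persistenceCollapse_iff_rowF1⟩

end Summit.NavierStokesRegularity.NavierStokesRegularity.Theorems.ScenarioCensus.TwoTimeTop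

namespace Summit.NavierStokesRegularity.NavierStokesRegularity.Theorems.ScenarioCensus

/-! ## Census KEYS (ns `…Theorems.ScenarioCensus`): the TWO-TIME members of row F1 (LINE 34) — TREE-decided F1dj / F1gl / F1ge / F1de and floors PT / TTF -/

/-- **Cell F1dj** (Type I · DISJOINT TOPS for some lag `θ > 0` ⇒ smooth extension past `T`): `:= TwoTimeTop.Row_F1dj`. DECIDED. -/
def Row_F1dj : Prop := TwoTimeTop.Row_F1dj
/-- F1dj is EXCLUDED (decided in the tree): `TwoTimeTop.rowF1dj_holds`. -/
theorem row_F1dj_excluded : Row_F1dj := TwoTimeTop.rowF1dj_holds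

/-- **Cell F1gl** (Type I · super-self-similar pointwise GROWTH on the top, LATE anchor, some lag): `:= TwoTimeTop.Row_F1gl`. DECIDED. -/
def Row_F1gl : Prop := TwoTimeTop.Row_F1gl
/-- F1gl is EXCLUDED (decided in the tree): `TwoTimeTop.rowF1gl_holds`. -/
theorem row_F1gl_excluded : Row_F1gl := TwoTimeTop.rowF1gl_holds

/-- **Cell F1ge** (the classical cell re-derived: super-self-similar growth, EARLY anchor): `:= TwoTimeTop.Row_F1ge`. DECIDED. -/
def Row_F1ge : Prop := TwoTimeTop.Row_F1ge
/-- F1ge is EXCLUDED (decided in the tree): `TwoTimeTop.rowF1ge_holds`. -/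
theorem row_F1ge_excluded : Row_F1ge := TwoTimeTop.rowF1ge_holds

/-- **Cell F1de** (fast DIMMING of every early-fast point, some lag `θ > 0`, ratio `q < 1`): `:= TwoTimeTop.Row_F1de`. DECIDED. -/
def Row_F1de : Prop := TwoTimeTop.Row_F1de
/-- F1de is EXCLUDED (decided in the tree): `TwoTimeTop.rowF1de_holds`. -/
theorem row_F1de_excluded : Row_F1de := TwoTimeTop.rowF1de_holds

/-- **Floor PT — PERSISTENT TOPS**: `TwoTimeTop.persistentTops_holds`. -/
theorem row_F1_persistentTops : TwoTimeTop.PersistentTops := TwoTimeTop.persistentTops_holds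
/-- **Floor TTF — TWO-TIME FLOOR**: `TwoTimeTop.twoTimeFloor_holds`. -/
theorem row_F1_twoTimeFloor : TwoTimeTop.TwoTimeFloor := TwoTimeTop.twoTimeFloor_holds

end Summit.NavierStokesRegularity.NavierStokesRegularity.Theorems.ScenarioCensus

end
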